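import Summits.Ventures.HSemireg.WedgeHankelRecurrenceDiscriminant

/-!
# Venture HSemireg — SYLVESTER'S WEIGHTED FORM `H_t(a·m′/m)`: for `m` monic of degree `t + 1` and any weight `a ∈ K[X]`, **`det H_t(a m′/m) = N_{K[X]/(m)∕K}(a) · disc(m)`**
# (N73's Kronecker–Hermite norm factorisation + N95's Borchardt–Hermite determinant), **`det ≠ 0 ⟺ (m, a) = 1 ∧ m separable`**, and in the split case the symbol `a m′/m` is the sequence of
# WEIGHTED POWER SUMS **`dualSeq (∏_{λ∈s}(X − λ)) (a · ∏′) = (Σ_{λ∈s} a(λ) λ^j)_j`** (Sylvester 1853: over `ℝ` the signature of this Hankel form counts the real roots with the sign of `a` —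
# signatures are not available here; we record the determinant, the non-vanishing criterion and the weighted partial-fraction expansion over any field)

HONEST FRAMING. Part of the Lean index of the computation cell `pub-hsemireg` (seat p10 gen 31, Sunday typer «UNIFORM-IN-n»).
LINEAR ALGEBRA OF HANKEL (catalecticant) MATRICES and of polynomials over a field ONLY (`Polynomial.modByMonic`, `Polynomial.derivative`, `Polynomial.discr`, `Algebra.norm`, `AdjoinRoot`): no variety,
no cohomology theory, no sheaf, no Ext group and no semiregularity map is constructed here; nothing here says that HC / HC_CM / HC_AV holds; no Literature fact is declared or used; no real
closed field ∕ signature statement is made.  Custodian versions as in `WedgeHankelSiegelIdeal` (1/3).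

WHAT IS IN THE TREE.  N32: `dualSeq_congr_mod`, `dualSeq_smul`.  N45: `dualSeq_add_dualSeq`.  N73: `det_hankelSq_dualSeq_eq_sign_mul_norm` (`det H_t(a/m) = sign(rev) · N(a)`), `det_hankelSq_dualSeq_ne_zero_iff`
(`≠ 0 ⟺ IsCoprime m a`).  N80: `dualSeq_X_sub_C_one`, `dualSeq_one_zero`.  N95 (`WedgeHankelRecurrenceDiscriminant`): `det_hankelSq_dualSeq_derivative` (`det H_t(m′/m) = m.discr`).  Mathlib: `map_mul`
(for `AdjoinRoot.mk` and `Algebra.norm`), `IsCoprime.mul_right_iff`, `Polynomial.separable_def`, `Polynomial.X_sub_C_dvd_sub_C_eval`, `Multiset.induction_on`.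
THIS FILE (namespace `Summit.Ventures.HSemireg.Wedge.HankelOuter` continued; PLAIN on N95; 0 definitions):
* §664 `dualSeq_X_sub_C` (`dualSeq (X − C c) a = (a(c) c^j)_j`), **`dualSeq_multiset_prod_X_sub_C_mul_derivative`** (weighted power sums `Σ a(λ) λ^j`, multiset of nodes, repetitions allowed),
  **`det_hankelSq_dualSeq_mul_derivative`** (`det H_t(a m′/m) = Algebra.norm K (mk a) · m.discr`), **`det_hankelSq_dualSeq_mul_derivative_ne_zero_iff`** (`≠ 0 ⟺ IsCoprime m a ∧ m.Separable`).
  The base-changed form `φ (dualSeq m (a m′) j) = Σ_{λ ∈ roots(φ m)} (φ a)(λ) λ^j` is three lines from N107 `dualSeq_map` (CLAIM #42) and is left to a CHAINED successor leaf so that this one is PLAIN.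
Nothing Ext-side.  New names only.
-/

open Module Polynomial
open scoped Matrix Polynomial

namespace Summit.Ventures.HSemireg.Wedge.HankelOuter

open Summit.Ventures.HSemireg.Wedge Summit.Ventures.HSemireg.Wedge.Hankel

variable (K : Type*) [Field K]

/-! ## §664. Sylvester's weighted Hankel form `H_t(a·m′/m)` -/

/-- The symbol of `a/(X − c)` is `(a(c) c^j)_j` (any `a`): `a ≡ a(c) (mod X − c)` and N80's geometric class. -/
theorem dualSeq_X_sub_C (c : K) (a : K[X]) : dualSeq K (Polynomial.X - C c) a = fun j => a.eval c * c ^ j := by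
  have h : dualSeq K (Polynomial.X - C c) a = dualSeq K (Polynomial.X - C c) (C (a.eval c)) :=
    dualSeq_congr_mod K (Polynomial.monic_X_sub_C c) (Polynomial.X_sub_C_dvd_sub_C_eval)
  rw [h, ← mul_one (C (a.eval c)), ← Polynomial.smul_eq_C_mul, dualSeq_smul, dualSeq_X_sub_C_one]
  funext j
  rw [Pi.smul_apply, smul_eq_mul]

/-- **Sylvester's weighted power sums: `dualSeq (∏_{λ ∈ s} (X − C λ)) (a · (∏_{λ ∈ s} (X − C λ))′) = (Σ_{λ ∈ s} a(λ) λ^j)_j`** for every multiset `s` of nodes (repetitions allowed) and every weight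
`a` — the partial-fraction expansion `a m′/m = Σ_λ a(λ)/(X − λ) (mod polynomials)`, by induction on `s` with N45's addition of symbols (`a = 1` is the power-sum case of N80 ∕ N107). -/
theorem dualSeq_multiset_prod_X_sub_C_mul_derivative (s : Multiset K) (a : K[X]) :
    dualSeq K (s.map fun c => Polynomial.X - C c).prod (a * derivative (s.map fun c => Polynomial.X - C c).prod) = fun j => (s.map fun c => a.eval c * c ^ j).sum := by
  induction s using Multiset.induction_on with
  | empty =>
    funext j
    rw [Multiset.map_zero, Multiset.prod_zero, Polynomial.derivative_one, mul_zero, dualSeq_one_zero, Multiset.map_zero, Multiset.sum_zero, Pi.zero_apply]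
  | cons c s ih =>
    have hm : (s.map fun c => Polynomial.X - C c).prod.Monic := Polynomial.monic_multiset_prod_of_monic _ _ fun c _ => Polynomial.monic_X_sub_C c
    funext j
    rw [Multiset.map_cons, Multiset.prod_cons, Polynomial.derivative_mul, Polynomial.derivative_X_sub_C, one_mul, mul_add,
      show a * ((Polynomial.X - C c) * derivative (s.map fun c => Polynomial.X - C c).prod) = (a * derivative (s.map fun c => Polynomial.X - C c).prod) * (Polynomial.X - C c) by ring,
      ← dualSeq_add_dualSeq K (Polynomial.monic_X_sub_C c) hm, dualSeq_X_sub_C, ih, Multiset.map_cons, Multiset.sum_cons]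
    rfl

/-- **`det H_t(a·m′/m) = N_{K[X]/(m)∕K}(a) · disc(m)`** (`m` monic of degree `t + 1`, any `a`, any field): N73's `det H_t(b/m) = sign · N(b)` at `b = a m′` and at `b = m′`, multiplicativity of the norm, and
N95's `det H_t(m′/m) = disc(m)`. -/
theorem det_hankelSq_dualSeq_mul_derivative {t : ℕ} {m : K[X]} (hm : m.Monic) (hmd : m.natDegree = t + 1) (a : K[X]) :
    (hankelSq K t (dualSeq K m (a * derivative m))).det = Algebra.norm K (AdjoinRoot.mk m a) * m.discr := by
  rw [det_hankelSq_dualSeq_eq_sign_mul_norm K hm hmd, map_mul, map_mul, ← det_hankelSq_dualSeq_derivative K hm hmd, det_hankelSq_dualSeq_eq_sign_mul_norm K hm hmd]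
  ring

/-- **`det H_t(a·m′/m) ≠ 0 ⟺ (m, a) = 1 ∧ m` separable** (`m` monic of degree `t + 1`): N73's criterion at `b = a m′` and `IsCoprime.mul_right_iff`. -/
theorem det_hankelSq_dualSeq_mul_derivative_ne_zero_iff [DecidableEq K] {t : ℕ} {m : K[X]} (hm : m.Monic) (hmd : m.natDegree = t + 1) (a : K[X]) :
    (hankelSq K t (dualSeq K m (a * derivative m))).det ≠ 0 ↔ IsCoprime m a ∧ m.Separable := by
  rw [det_hankelSq_dualSeq_ne_zero_iff K hm hmd, IsCoprime.mul_right_iff, Polynomial.separable_def]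

/-- The norm form of the criterion: `Algebra.norm K (mk a) · disc(m) ≠ 0 ⟺ (m, a) = 1 ∧ m` separable (`m` monic of positive degree). -/
theorem norm_mul_discr_ne_zero_iff [DecidableEq K] {t : ℕ} {m : K[X]} (hm : m.Monic) (hmd : m.natDegree = t + 1) (a : K[X]) :
    Algebra.norm K (AdjoinRoot.mk m a) * m.discr ≠ 0 ↔ IsCoprime m a ∧ m.Separable := by
  rw [← det_hankelSq_dualSeq_mul_derivative K hm hmd, det_hankelSq_dualSeq_mul_derivative_ne_zero_iff K hm hmd]

end Summit.Ventures.HSemireg.Wedge.HankelOuter
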